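import Mathlib
import HarnessLib
import Literature.Analysis.FluidPDE.AxisymHouLiVariables
import Summits.NavierStokesRegularity.NavierStokesRegularity.Theorems.AxisTwistDoorAveragedConeLiouvilleCircleSwirl

/-!
# Route `HalfSpaceWindowDoor`, crux `CirculationCarryingRigidity` (stmt-NavierStokesRegularity-25311) —
# line `angular_flux` (LEAD ns-hsw-p1 g13): the CONSERVATIVE form of the circle law — LRT's circle term is the
# divergence of the VELOCITY-ONLY angular-momentum fluxes `S = ∮ v_r v_θ dl`, `P = ∮ v₃ v_θ dl`

The circle-averaged swirl law of the tree (AxisTwistDoor `circleSwirl_identity` / `circleSwirlEquation_of_classical`,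
Lei–Ren–Tian arXiv:2501.08976 eq. (Gamma-30)) reads `∂ₛΓ = Γ_rr − r⁻¹Γ_r + Γ_zz − T` with the CIRCLE TERM
`T(r,z,s) = ∮_{S(r,z)} (v_r ω₃ − ω_r v₃) dl` (`…Defs.circleTerm`), which carries the vorticity.  This file proves the
KINEMATIC identity (any `C¹` divergence-free slice, `r ≠ 0`)

  `T = ∂ᵣS + r⁻¹ S + ∂_z P`,   `S(r,z,s) = ∮_{S(r,z)} v_r v_θ dl`,  `P(r,z,s) = ∮_{S(r,z)} v₃ v_θ dl`

(`circleTerm_eq_fluxDiv`; the `e_θ`-component of the Lamb vector is `div(v · r v_θ)/r` up to the exact `θ`-derivative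
`∂_θ ½(v_r² + v₃² − v_θ²)`, `integral_thetaDeriv_eq_zero`), hence the **angular-momentum balance in conservative form**
`∂ₛΓ = Γ_rr − r⁻¹Γ_r + Γ_zz − ∂ᵣS − r⁻¹S − ∂_zP` for classical Navier–Stokes solutions and for every profile of the door
class (`circ_conservation_law`, `circ_conservation_law_of_class`).
(`S`, `P` are written as the explicit circle integrals `∫₀^{2π} ⟪v,e_r⟫⟪v,e_θ⟫ r dθ`, `∫₀^{2π} ⟪v,e₃⟫⟪v,e_θ⟫ r dθ` throughout;
no new definitions.)  The fluxes involve NO vorticity, NO velocity gradient and NO pressure (the pressure torque averages out):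
`|S|, |P| ≤ 2π r B²` whenever `‖v(s)‖ ≤ B` on the circle (`abs_radFlux_le`, `abs_axFlux_le`), so in the door class
`|S|, |P| ≤ 2π r C²/(−s)` (`abs_radFlux_le_of_class`, `abs_axFlux_le_of_class`).  READING (card `Lines/angular_flux.md`):
the obstruction `∮ω_r v₃ dl` of the hemisphere case (the one place where Lei–Ren–Tian §4 spend the cone condition
`|ω_h| ≤ C ω₃`) is, after the cancellation of `∮v_r ω₃ dl`, the divergence of bounded velocity-quadratic fluxes of
CRITICAL size; the companion file `…AngularFluxTightness` shows that this balance together with every class/ledger bound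
on `(Γ, S, P)` and the sign is satisfied by an explicit non-trivial hourglass — the one-axis circle calculus alone cannot
prove W6.  Sign-free file (usable verbatim for the sister crux 19708 and AxisTwistDoor).

Seat ns-hsw-p1 g13 (LEAD of 25311, cell pub-ns-dss), `--supports stmt-NavierStokesRegularity-25311 --as helper`.
WHAT THIS IS NOT: not a statement about Navier–Stokes regularity (Clay A); circle calculus for HYPOTHETICAL blow-up
profiles (KNSS ancient mild solutions); the item stays OPEN at its research stub; nothing is closed by this file.
-/

noncomputable section

-- the summit and its single sub-problem share the name (CONVENTIONS §1), as in every Theorems file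
set_option linter.dupNamespace false

namespace Summit.NavierStokesRegularity.NavierStokesRegularity.Theorems.HalfSpaceWindowDoorCirculationCarryingRigidityAngularFlux

open scoped Topology InnerProductSpace RealInnerProductSpace
open Set Function MeasureTheory intervalIntegral Filter
open Literature.Analysis Literature.Analysis.FunctionSpaces Literature.Analysis.UnboundedOperators
open Literature.Analysis.FluidPDE hiding eR
open Summit.NavierStokesRegularity.NavierStokesRegularity.Theorems.AxisTwistDoorAveragedConeLiouvilleDefs
  (cylPt eR eT e3 circ vortCirc radVortCirc circleTerm meanR meanZ remainder)
open Summit.NavierStokesRegularity.NavierStokesRegularity.Theorems.AveragedConeLiouville.CircleStokes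
  (cylPt_two_pi eR_two_pi eR_eq eT_eq inner_e3 continuous_eR continuous_eT contDiff_cylPt contDiff_eT
    hasDerivAt_cylPt_r hasDerivAt_cylPt_theta hasDerivAt_eR hasDerivAt_radial_theta deriv_circ_eq_vortCirc)
open Summit.NavierStokesRegularity.NavierStokesRegularity.Theorems.AxisTwistDoorAveragedConeLiouvilleCylFrame
  (inner_eR inner_eT abs_inner_eR_le abs_inner_eT_le abs_inner_e3_le continuous_cylPt_θ hasDerivAt_cylPt_z e3_eq)
open Summit.NavierStokesRegularity.NavierStokesRegularity.Theorems.AveragedConeLiouville.CircleCalculus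
  (hasDerivAt_intervalIntegral_of_contDiff contDiff_cylPt_z deriv_circ_z)
open Summit.NavierStokesRegularity.NavierStokesRegularity.Theorems.AveragedConeLiouville.CircleSwirl
  (circleSwirl_identity circleTerm_eq)
open Summit.NavierStokesRegularity.NavierStokesRegularity.Theorems
  (exists_isClassicalNSSolutionOn_Iio_of_isTypeIAncientMild)
open Summit.NavierStokesRegularity.NavierStokesRegularity.Theorems.PoloidalWindowDoorPoloidalWindowRigidityWindow
  (isTypeIAncientMild_of_class)

variable {v : ℝ → EuclideanSpace ℝ (Fin 3) → EuclideanSpace ℝ (Fin 3)}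

/-! ### Frame facts -/

/-- `∂_θ e_θ = −e_r`. -/
theorem hasDerivAt_eT (θ : ℝ) : HasDerivAt eT (-eR θ) θ := by
  rw [show eT = fun θ => -Real.sin θ • (EuclideanSpace.single (0 : Fin 3) (1 : ℝ))
      + Real.cos θ • (EuclideanSpace.single (1 : Fin 3) (1 : ℝ)) from funext eT_eq]
  have h := ((Real.hasDerivAt_sin θ).neg.smul_const (EuclideanSpace.single (0 : Fin 3) (1 : ℝ))).add
    ((Real.hasDerivAt_cos θ).smul_const (EuclideanSpace.single (1 : Fin 3) (1 : ℝ)))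
  refine h.congr_deriv ?_
  ext i
  fin_cases i <;> simp [eR]

/-- The frame is `2π`-periodic: `e_θ(2π) = e_θ(0)`. -/
theorem eT_two_pi : eT (2 * Real.pi) = eT 0 := by simp [eT]

/-! ### The pointwise identity: Lamb `e_θ`-component = flux divergence − an exact `θ`-derivative -/

section Pointwise

variable {w : EuclideanSpace ℝ (Fin 3) → EuclideanSpace ℝ (Fin 3)}

/-- **Pointwise algebra behind `T = ∂ᵣS + S/r + ∂_zP`** at `p = cylPt r θ z` (`L = Dw(p)`, `a = w(p)`, `div w (p) = 0`):
(∂ᵣ-integrand of `S`) + `a_r a_θ` + (∂_z-integrand of `P`) = (integrand of `T`) + `∂_θ ½(a_r² + a₃² − a_θ²)`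
(uses only `tr L = 0` and `cos² + sin² = 1`). -/
theorem flux_pointwise (r θ z : ℝ) (hdiv : VectorCalculus.divergence w (cylPt r θ z) = 0) :
    (⟪fderiv ℝ w (cylPt r θ z) (eR θ), eR θ⟫_ℝ * ⟪w (cylPt r θ z), eT θ⟫_ℝ * r
        + ⟪w (cylPt r θ z), eR θ⟫_ℝ * ⟪fderiv ℝ w (cylPt r θ z) (eR θ), eT θ⟫_ℝ * r
        + ⟪w (cylPt r θ z), eR θ⟫_ℝ * ⟪w (cylPt r θ z), eT θ⟫_ℝ)
      + ⟪w (cylPt r θ z), eR θ⟫_ℝ * ⟪w (cylPt r θ z), eT θ⟫_ℝ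
      + (⟪fderiv ℝ w (cylPt r θ z) e3, e3⟫_ℝ * ⟪w (cylPt r θ z), eT θ⟫_ℝ
          + ⟪w (cylPt r θ z), e3⟫_ℝ * ⟪fderiv ℝ w (cylPt r θ z) e3, eT θ⟫_ℝ) * r
    = (⟪w (cylPt r θ z), eR θ⟫_ℝ * ⟪curl w (cylPt r θ z), e3⟫_ℝ
          - ⟪curl w (cylPt r θ z), eR θ⟫_ℝ * ⟪w (cylPt r θ z), e3⟫_ℝ) * r
      + (⟪w (cylPt r θ z), eR θ⟫_ℝ * (⟪fderiv ℝ w (cylPt r θ z) (r • eT θ), eR θ⟫_ℝ + ⟪w (cylPt r θ z), eT θ⟫_ℝ)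
          + ⟪w (cylPt r θ z), e3⟫_ℝ * ⟪fderiv ℝ w (cylPt r θ z) (r • eT θ), e3⟫_ℝ
          - ⟪w (cylPt r θ z), eT θ⟫_ℝ * (⟪fderiv ℝ w (cylPt r θ z) (r • eT θ), eT θ⟫_ℝ - ⟪w (cylPt r θ z), eR θ⟫_ℝ)) := by
  set L := fderiv ℝ w (cylPt r θ z) with hL
  set a := w (cylPt r θ z) with ha
  have h0 : curl w (cylPt r θ z) 0 = L (EuclideanSpace.single 1 1) 2 - L (EuclideanSpace.single 2 1) 1 := by simp [curl, hL]
  have h1 : curl w (cylPt r θ z) 1 = L (EuclideanSpace.single 2 1) 0 - L (EuclideanSpace.single 0 1) 2 := by simp [curl, hL]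
  have h2 : curl w (cylPt r θ z) 2 = L (EuclideanSpace.single 0 1) 1 - L (EuclideanSpace.single 1 1) 0 := by simp [curl, hL]
  have hdiv' : L (EuclideanSpace.single 0 1) 0 + L (EuclideanSpace.single 1 1) 1 + L (EuclideanSpace.single 2 1) 2 = 0 := by
    rw [hL, ← divergence_eq_sum_three]; exact hdiv
  rw [inner_eR (curl w (cylPt r θ z)), inner_e3 (curl w (cylPt r θ z)), h0, h1, h2]
  rw [inner_eR a, inner_eT a, inner_e3 a, eR_eq, eT_eq, e3_eq]
  simp only [map_add, map_smul, map_neg, smul_add, inner_add_left, inner_add_right, inner_smul_left,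
    inner_smul_right, inner_neg_left, inner_neg_right, smul_neg, neg_smul,
    EuclideanSpace.inner_single_right, RCLike.conj_to_real]
  have h := Real.sin_sq_add_cos_sq θ
  set c := Real.cos θ
  set σ := Real.sin θ
  set a00 := L (EuclideanSpace.single (0 : Fin 3) (1 : ℝ)) 0
  set a01 := L (EuclideanSpace.single (0 : Fin 3) (1 : ℝ)) 1
  set a02 := L (EuclideanSpace.single (0 : Fin 3) (1 : ℝ)) 2
  set a10 := L (EuclideanSpace.single (1 : Fin 3) (1 : ℝ)) 0
  set a11 := L (EuclideanSpace.single (1 : Fin 3) (1 : ℝ)) 1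
  set a12 := L (EuclideanSpace.single (1 : Fin 3) (1 : ℝ)) 2
  set a20 := L (EuclideanSpace.single (2 : Fin 3) (1 : ℝ)) 0
  set a21 := L (EuclideanSpace.single (2 : Fin 3) (1 : ℝ)) 1
  set a22 := L (EuclideanSpace.single (2 : Fin 3) (1 : ℝ)) 2
  linear_combination ((-(a 0 * σ) + a 1 * c) * r) * hdiv'
    + (((-(a 0 * σ) + a 1 * c) * r * (a00 + a11)) + ((a 0 * c + a 1 * σ) * r * (a01 - a10))) * h

end Pointwise

/-! ### The exact `θ`-derivative integrates to zero over the circle -/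

section Circle

variable {w : EuclideanSpace ℝ (Fin 3) → EuclideanSpace ℝ (Fin 3)}

/-- `∂_θ ½(a_r² + a₃² − a_θ²)` along the circle, for a `C¹` field `w` (`a = w(cylPt r θ z)`). -/
theorem hasDerivAt_halfSq (hw : ContDiff ℝ 1 w) (r θ z : ℝ) :
    HasDerivAt (fun θ' => (⟪w (cylPt r θ' z), eR θ'⟫_ℝ ^ 2 + ⟪w (cylPt r θ' z), e3⟫_ℝ ^ 2
        - ⟪w (cylPt r θ' z), eT θ'⟫_ℝ ^ 2) / 2)
      (⟪w (cylPt r θ z), eR θ⟫_ℝ * (⟪fderiv ℝ w (cylPt r θ z) (r • eT θ), eR θ⟫_ℝ + ⟪w (cylPt r θ z), eT θ⟫_ℝ)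
          + ⟪w (cylPt r θ z), e3⟫_ℝ * ⟪fderiv ℝ w (cylPt r θ z) (r • eT θ), e3⟫_ℝ
          - ⟪w (cylPt r θ z), eT θ⟫_ℝ * (⟪fderiv ℝ w (cylPt r θ z) (r • eT θ), eT θ⟫_ℝ - ⟪w (cylPt r θ z), eR θ⟫_ℝ)) θ := by
  have h1 : HasDerivAt (fun θ' => w (cylPt r θ' z)) (fderiv ℝ w (cylPt r θ z) (r • eT θ)) θ :=
    ((hw.differentiable one_ne_zero) _).hasFDerivAt.comp_hasDerivAt θ (hasDerivAt_cylPt_theta r θ z)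
  have hR : HasDerivAt (fun θ' => ⟪w (cylPt r θ' z), eR θ'⟫_ℝ)
      (⟪fderiv ℝ w (cylPt r θ z) (r • eT θ), eR θ⟫_ℝ + ⟪w (cylPt r θ z), eT θ⟫_ℝ) θ := by
    refine (h1.inner ℝ (hasDerivAt_eR θ)).congr_deriv ?_; simp only [real_inner_comm]; ring
  have hT : HasDerivAt (fun θ' => ⟪w (cylPt r θ' z), eT θ'⟫_ℝ)
      (⟪fderiv ℝ w (cylPt r θ z) (r • eT θ), eT θ⟫_ℝ - ⟪w (cylPt r θ z), eR θ⟫_ℝ) θ := by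
    refine (h1.inner ℝ (hasDerivAt_eT θ)).congr_deriv ?_; simp only [inner_neg_right, real_inner_comm]; ring
  have h3 : HasDerivAt (fun θ' => ⟪w (cylPt r θ' z), e3⟫_ℝ) (⟪fderiv ℝ w (cylPt r θ z) (r • eT θ), e3⟫_ℝ) θ := by
    simpa using h1.inner ℝ (hasDerivAt_const θ e3)
  refine ((((hR.pow 2).add (h3.pow 2)).sub (hT.pow 2)).div_const 2).congr_deriv ?_
  simp only [Nat.cast_ofNat]
  ring

/-- The derivative above is continuous in `θ` (for the fundamental theorem of calculus). -/
theorem continuous_halfSq_deriv (hw : ContDiff ℝ 1 w) (r z : ℝ) :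
    Continuous fun θ =>
      ⟪w (cylPt r θ z), eR θ⟫_ℝ * (⟪fderiv ℝ w (cylPt r θ z) (r • eT θ), eR θ⟫_ℝ + ⟪w (cylPt r θ z), eT θ⟫_ℝ)
        + ⟪w (cylPt r θ z), e3⟫_ℝ * ⟪fderiv ℝ w (cylPt r θ z) (r • eT θ), e3⟫_ℝ
        - ⟪w (cylPt r θ z), eT θ⟫_ℝ * (⟪fderiv ℝ w (cylPt r θ z) (r • eT θ), eT θ⟫_ℝ - ⟪w (cylPt r θ z), eR θ⟫_ℝ) := by
  have hp := continuous_cylPt_θ r z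
  have ha : Continuous fun θ => w (cylPt r θ z) := hw.continuous.comp hp
  have hL : Continuous fun θ => fderiv ℝ w (cylPt r θ z) (r • eT θ) :=
    ((hw.continuous_fderiv one_ne_zero).comp hp).clm_apply (continuous_eT.const_smul r)
  have hR : Continuous fun θ => ⟪w (cylPt r θ z), eR θ⟫_ℝ := ha.inner continuous_eR
  have hT : Continuous fun θ => ⟪w (cylPt r θ z), eT θ⟫_ℝ := ha.inner continuous_eT
  have h3 : Continuous fun θ => ⟪w (cylPt r θ z), e3⟫_ℝ := ha.inner continuous_const
  exact ((hR.mul ((hL.inner continuous_eR).add hT)).add (h3.mul (hL.inner continuous_const))).sub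
    (hT.mul ((hL.inner continuous_eT).sub hR))

/-- **`∮ ∂_θ ½(v_r² + v₃² − v_θ²) dθ = 0`** (periodicity of the frame and of the circle). -/
theorem integral_thetaDeriv_eq_zero (hw : ContDiff ℝ 1 w) (r z : ℝ) :
    ∫ θ in (0 : ℝ)..(2 * Real.pi),
      (⟪w (cylPt r θ z), eR θ⟫_ℝ * (⟪fderiv ℝ w (cylPt r θ z) (r • eT θ), eR θ⟫_ℝ + ⟪w (cylPt r θ z), eT θ⟫_ℝ)
        + ⟪w (cylPt r θ z), e3⟫_ℝ * ⟪fderiv ℝ w (cylPt r θ z) (r • eT θ), e3⟫_ℝ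
        - ⟪w (cylPt r θ z), eT θ⟫_ℝ * (⟪fderiv ℝ w (cylPt r θ z) (r • eT θ), eT θ⟫_ℝ - ⟪w (cylPt r θ z), eR θ⟫_ℝ))
      = 0 := by
  rw [integral_eq_sub_of_hasDerivAt (fun θ _ => hasDerivAt_halfSq hw r θ z)
    ((continuous_halfSq_deriv hw r z).intervalIntegrable _ _), cylPt_two_pi, eR_two_pi, eT_two_pi, sub_self]

end Circle

/-! ### The kinematic identity `T = ∂ᵣS + r⁻¹S + ∂_zP` -/

/-- **`∂ᵣS`** for a `C¹` slice: `d/dr ∫₀^{2π} a_r a_θ r dθ = ∫₀^{2π} (⟪Le_r,e_r⟫a_θ r + a_r⟪Le_r,e_θ⟫ r + a_r a_θ) dθ`. -/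
theorem hasDerivAt_radFlux {s : ℝ} (hw : ContDiff ℝ 1 (v s)) (r z : ℝ) :
    HasDerivAt (fun r' => (∫ θ in (0 : ℝ)..(2 * Real.pi), ⟪v s (cylPt r' θ z), eR θ⟫_ℝ * ⟪v s (cylPt r' θ z), eT θ⟫_ℝ * r'))
      (∫ θ in (0 : ℝ)..(2 * Real.pi),
        (⟪fderiv ℝ (v s) (cylPt r θ z) (eR θ), eR θ⟫_ℝ * ⟪v s (cylPt r θ z), eT θ⟫_ℝ * r
          + ⟪v s (cylPt r θ z), eR θ⟫_ℝ * ⟪fderiv ℝ (v s) (cylPt r θ z) (eR θ), eT θ⟫_ℝ * r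
          + ⟪v s (cylPt r θ z), eR θ⟫_ℝ * ⟪v s (cylPt r θ z), eT θ⟫_ℝ)) r := by
  have hH : ContDiff ℝ 1 fun q : ℝ × ℝ => ⟪v s (cylPt q.2 q.1 z), eR q.1⟫_ℝ * ⟪v s (cylPt q.2 q.1 z), eT q.1⟫_ℝ * q.2 := by
    have h1 : ContDiff ℝ 1 fun q : ℝ × ℝ => v s (cylPt q.2 q.1 z) := hw.comp (contDiff_cylPt z)
    have hr : ContDiff ℝ 1 fun q : ℝ × ℝ => eR q.1 :=
      Summit.NavierStokesRegularity.NavierStokesRegularity.Theorems.AveragedConeLiouville.CircleCalculus.contDiff_eR.comp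
        contDiff_fst
    have ht : ContDiff ℝ 1 fun q : ℝ × ℝ => eT q.1 := contDiff_eT.comp contDiff_fst
    exact ((h1.inner ℝ hr).mul (h1.inner ℝ ht)).mul contDiff_snd
  refine hasDerivAt_intervalIntegral_of_contDiff hH r fun θ => ?_
  have h1 : HasDerivAt (fun r' => v s (cylPt r' θ z)) (fderiv ℝ (v s) (cylPt r θ z) (eR θ)) r :=
    ((hw.differentiable one_ne_zero) _).hasFDerivAt.comp_hasDerivAt r (hasDerivAt_cylPt_r r θ z)
  have hR : HasDerivAt (fun r' => ⟪v s (cylPt r' θ z), eR θ⟫_ℝ) (⟪fderiv ℝ (v s) (cylPt r θ z) (eR θ), eR θ⟫_ℝ) r := by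
    simpa using h1.inner ℝ (hasDerivAt_const r (eR θ))
  have hT : HasDerivAt (fun r' => ⟪v s (cylPt r' θ z), eT θ⟫_ℝ) (⟪fderiv ℝ (v s) (cylPt r θ z) (eR θ), eT θ⟫_ℝ) r := by
    simpa using h1.inner ℝ (hasDerivAt_const r (eT θ))
  have h := (hR.mul hT).mul (hasDerivAt_id r)
  refine h.congr_deriv ?_
  simp only [id, Pi.mul_apply]
  ring

/-- **`∂_zP`** for a `C¹` slice: `d/dz ∫₀^{2π} a₃ a_θ r dθ = ∫₀^{2π} (⟪Le₃,e₃⟫a_θ + a₃⟪Le₃,e_θ⟫) r dθ`. -/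
theorem hasDerivAt_axFlux {s : ℝ} (hw : ContDiff ℝ 1 (v s)) (r z : ℝ) :
    HasDerivAt (fun z' => (∫ θ in (0 : ℝ)..(2 * Real.pi), ⟪v s (cylPt r θ z'), e3⟫_ℝ * ⟪v s (cylPt r θ z'), eT θ⟫_ℝ * r))
      (∫ θ in (0 : ℝ)..(2 * Real.pi),
        (⟪fderiv ℝ (v s) (cylPt r θ z) e3, e3⟫_ℝ * ⟪v s (cylPt r θ z), eT θ⟫_ℝ
          + ⟪v s (cylPt r θ z), e3⟫_ℝ * ⟪fderiv ℝ (v s) (cylPt r θ z) e3, eT θ⟫_ℝ) * r) z := by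
  have hH : ContDiff ℝ 1 fun q : ℝ × ℝ => ⟪v s (cylPt r q.1 q.2), e3⟫_ℝ * ⟪v s (cylPt r q.1 q.2), eT q.1⟫_ℝ * r := by
    have h1 : ContDiff ℝ 1 fun q : ℝ × ℝ => v s (cylPt r q.1 q.2) := hw.comp (contDiff_cylPt_z r)
    have ht : ContDiff ℝ 1 fun q : ℝ × ℝ => eT q.1 := contDiff_eT.comp contDiff_fst
    exact ((h1.inner ℝ contDiff_const).mul (h1.inner ℝ ht)).mul contDiff_const
  refine hasDerivAt_intervalIntegral_of_contDiff hH z fun θ => ?_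
  have h1 : HasDerivAt (fun z' => v s (cylPt r θ z')) (fderiv ℝ (v s) (cylPt r θ z) e3) z :=
    ((hw.differentiable one_ne_zero) _).hasFDerivAt.comp_hasDerivAt z (hasDerivAt_cylPt_z r θ z)
  have h3 : HasDerivAt (fun z' => ⟪v s (cylPt r θ z'), e3⟫_ℝ) (⟪fderiv ℝ (v s) (cylPt r θ z) e3, e3⟫_ℝ) z := by
    simpa using h1.inner ℝ (hasDerivAt_const z e3)
  have hT : HasDerivAt (fun z' => ⟪v s (cylPt r θ z'), eT θ⟫_ℝ) (⟪fderiv ℝ (v s) (cylPt r θ z) e3, eT θ⟫_ℝ) z := by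
    simpa using h1.inner ℝ (hasDerivAt_const z (eT θ))
  have h := (h3.mul hT).mul_const r
  refine h.congr_deriv ?_
  ring

/-- `r⁻¹ S = ∫₀^{2π} a_r a_θ dθ` for `r ≠ 0`. -/
theorem inv_mul_radFlux {s r : ℝ} (hr : r ≠ 0) (z : ℝ) :
    r⁻¹ * (∫ θ in (0 : ℝ)..(2 * Real.pi), ⟪v s (cylPt r θ z), eR θ⟫_ℝ * ⟪v s (cylPt r θ z), eT θ⟫_ℝ * r)
      = ∫ θ in (0 : ℝ)..(2 * Real.pi), ⟪v s (cylPt r θ z), eR θ⟫_ℝ * ⟪v s (cylPt r θ z), eT θ⟫_ℝ := by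
  rw [intervalIntegral.integral_mul_const]; field_simp

/-- **THE KINEMATIC IDENTITY `T = ∂ᵣS + r⁻¹S + ∂_zP`** for a `C¹` divergence-free slice and `r ≠ 0`: LRT's circle term
`∮(v_r ω₃ − ω_r v₃) dl` is the (cylindrical) divergence `r⁻¹∂ᵣ(rS) + ∂_zP` of the two velocity-only angular-momentum fluxes.
No vorticity, velocity gradient or pressure survives on the right. -/
theorem circleTerm_eq_fluxDiv {s : ℝ} (hv : ContDiff ℝ 1 (v s)) (hdiv : VectorCalculus.IsDivFree (v s))
    {r : ℝ} (hr : r ≠ 0) (z : ℝ) :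
    circleTerm v r z s
      = deriv (fun r' => ∫ θ in (0 : ℝ)..(2 * Real.pi), ⟪v s (cylPt r' θ z), eR θ⟫_ℝ * ⟪v s (cylPt r' θ z), eT θ⟫_ℝ * r') r
          + r⁻¹ * (∫ θ in (0 : ℝ)..(2 * Real.pi), ⟪v s (cylPt r θ z), eR θ⟫_ℝ * ⟪v s (cylPt r θ z), eT θ⟫_ℝ * r)
          + deriv (fun z' => ∫ θ in (0 : ℝ)..(2 * Real.pi), ⟪v s (cylPt r θ z'), e3⟫_ℝ * ⟪v s (cylPt r θ z'), eT θ⟫_ℝ * r) z := by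
  rw [(hasDerivAt_radFlux hv r z).deriv, (hasDerivAt_axFlux hv r z).deriv, inv_mul_radFlux hr z]
  -- continuity of everything along the circle
  have hp := continuous_cylPt_θ r z
  have ha : Continuous fun θ => v s (cylPt r θ z) := hv.continuous.comp hp
  have hD : Continuous fun θ => fderiv ℝ (v s) (cylPt r θ z) := (hv.continuous_fderiv one_ne_zero).comp hp
  have hω : Continuous fun θ => curl (v s) (cylPt r θ z) := (continuous_curl hv).comp hp
  have hR : Continuous fun θ => ⟪v s (cylPt r θ z), eR θ⟫_ℝ := ha.inner continuous_eR
  have hT : Continuous fun θ => ⟪v s (cylPt r θ z), eT θ⟫_ℝ := ha.inner continuous_eT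
  have h3 : Continuous fun θ => ⟪v s (cylPt r θ z), e3⟫_ℝ := ha.inner continuous_const
  have hLRR : Continuous fun θ => ⟪fderiv ℝ (v s) (cylPt r θ z) (eR θ), eR θ⟫_ℝ := (hD.clm_apply continuous_eR).inner continuous_eR
  have hLRT : Continuous fun θ => ⟪fderiv ℝ (v s) (cylPt r θ z) (eR θ), eT θ⟫_ℝ := (hD.clm_apply continuous_eR).inner continuous_eT
  have hL33 : Continuous fun θ => ⟪fderiv ℝ (v s) (cylPt r θ z) e3, e3⟫_ℝ := (hD.clm_apply continuous_const).inner continuous_const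
  have hL3T : Continuous fun θ => ⟪fderiv ℝ (v s) (cylPt r θ z) e3, eT θ⟫_ℝ := (hD.clm_apply continuous_const).inner continuous_eT
  have hI1 : IntervalIntegrable (fun θ =>
      ⟪fderiv ℝ (v s) (cylPt r θ z) (eR θ), eR θ⟫_ℝ * ⟪v s (cylPt r θ z), eT θ⟫_ℝ * r
        + ⟪v s (cylPt r θ z), eR θ⟫_ℝ * ⟪fderiv ℝ (v s) (cylPt r θ z) (eR θ), eT θ⟫_ℝ * r
        + ⟪v s (cylPt r θ z), eR θ⟫_ℝ * ⟪v s (cylPt r θ z), eT θ⟫_ℝ) volume 0 (2 * Real.pi) :=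
    ((((hLRR.mul hT).mul continuous_const).add ((hR.mul hLRT).mul continuous_const)).add (hR.mul hT)).intervalIntegrable _ _
  have hI2 : IntervalIntegrable (fun θ => ⟪v s (cylPt r θ z), eR θ⟫_ℝ * ⟪v s (cylPt r θ z), eT θ⟫_ℝ) volume 0 (2 * Real.pi) :=
    (hR.mul hT).intervalIntegrable _ _
  have hI3 : IntervalIntegrable (fun θ =>
      (⟪fderiv ℝ (v s) (cylPt r θ z) e3, e3⟫_ℝ * ⟪v s (cylPt r θ z), eT θ⟫_ℝ
        + ⟪v s (cylPt r θ z), e3⟫_ℝ * ⟪fderiv ℝ (v s) (cylPt r θ z) e3, eT θ⟫_ℝ) * r) volume 0 (2 * Real.pi) :=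
    (((hL33.mul hT).add (h3.mul hL3T)).mul continuous_const).intervalIntegrable _ _
  have hIT : IntervalIntegrable (fun θ =>
      (⟪v s (cylPt r θ z), eR θ⟫_ℝ * ⟪curl (v s) (cylPt r θ z), e3⟫_ℝ
        - ⟪curl (v s) (cylPt r θ z), eR θ⟫_ℝ * ⟪v s (cylPt r θ z), e3⟫_ℝ) * r) volume 0 (2 * Real.pi) :=
    (((hR.mul (hω.inner continuous_const)).sub ((hω.inner continuous_eR).mul h3)).mul continuous_const).intervalIntegrable _ _
  have hID : IntervalIntegrable (fun θ =>
      ⟪v s (cylPt r θ z), eR θ⟫_ℝ * (⟪fderiv ℝ (v s) (cylPt r θ z) (r • eT θ), eR θ⟫_ℝ + ⟪v s (cylPt r θ z), eT θ⟫_ℝ)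
        + ⟪v s (cylPt r θ z), e3⟫_ℝ * ⟪fderiv ℝ (v s) (cylPt r θ z) (r • eT θ), e3⟫_ℝ
        - ⟪v s (cylPt r θ z), eT θ⟫_ℝ * (⟪fderiv ℝ (v s) (cylPt r θ z) (r • eT θ), eT θ⟫_ℝ - ⟪v s (cylPt r θ z), eR θ⟫_ℝ))
      volume 0 (2 * Real.pi) := (continuous_halfSq_deriv hv r z).intervalIntegrable _ _
  rw [← intervalIntegral.integral_add hI1 hI2, ← intervalIntegral.integral_add (hI1.add hI2) hI3,
    intervalIntegral.integral_congr (fun θ _ => flux_pointwise r θ z (hdiv (cylPt r θ z))),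
    intervalIntegral.integral_add hIT hID, integral_thetaDeriv_eq_zero hv r z, add_zero]
  rfl

/-! ### The angular-momentum balance in conservative form -/

section Law

variable {S : Set ℝ} {u : ℝ → EuclideanSpace ℝ (Fin 3) → EuclideanSpace ℝ (Fin 3)} {q : ℝ → EuclideanSpace ℝ (Fin 3) → ℝ}

/-- **CONSERVATIVE CIRCLE LAW for classical Navier–Stokes solutions** (unit viscosity, unforced) on an open time set
`S ∋ s`, `r ≠ 0`: `∂ₛΓ = Γ_rr − r⁻¹Γ_r + Γ_zz − (∂ᵣS + r⁻¹S + ∂_zP)` — the `θ`-averaged axial angular-momentum balance;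
the pressure torque has averaged out and no vorticity appears (AxisTwistDoor `circleSwirl_identity` + `circleTerm_eq` +
`circleTerm_eq_fluxDiv`). -/
theorem circ_conservation_law (hS : IsOpen S) (hcl : IsClassicalNSSolutionOn S 1 0 u q) {s : ℝ} (hs : s ∈ S)
    {r : ℝ} (hr : r ≠ 0) (z : ℝ) :
    deriv (fun s' => circ u r z s') s
      = deriv (fun r' => deriv (fun r'' => circ u r'' z s) r') r - r⁻¹ * deriv (fun r' => circ u r' z s) r
        + deriv (fun z' => deriv (fun z'' => circ u r z'' s) z') z
        - (deriv (fun r' => ∫ θ in (0 : ℝ)..(2 * Real.pi), ⟪u s (cylPt r' θ z), eR θ⟫_ℝ * ⟪u s (cylPt r' θ z), eT θ⟫_ℝ * r') r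
            + r⁻¹ * (∫ θ in (0 : ℝ)..(2 * Real.pi), ⟪u s (cylPt r θ z), eR θ⟫_ℝ * ⟪u s (cylPt r θ z), eT θ⟫_ℝ * r)
            + deriv (fun z' => ∫ θ in (0 : ℝ)..(2 * Real.pi), ⟪u s (cylPt r θ z'), e3⟫_ℝ * ⟪u s (cylPt r θ z'), eT θ⟫_ℝ * r) z) := by
  have hC1 : ContDiff ℝ 1 (u s) := (hcl.contDiff_velocity hs).of_le (by norm_cast)
  have hid := circleSwirl_identity hS hcl hs hr z
  have hrem := circleTerm_eq u hC1 r z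
  have hdr : deriv (fun r' => circ u r' z s) r = vortCirc u r z s := deriv_circ_eq_vortCirc u hC1 r z
  have hdz : deriv (fun z' => circ u r z' s) z = -radVortCirc u r z s := deriv_circ_z u hC1 r z
  have hT := circleTerm_eq_fluxDiv hC1 (hcl.divFree s hs) hr z
  rw [hdr, hdz] at hid
  rw [hdr]
  linarith [hid, hrem, hT]

/-- **CONSERVATIVE CIRCLE LAW in the door class.**  For every profile of the door's Type-I ancient Oseen-mild class
(Type-I time rate, continuity on the open lower slab, unit-viscosity Oseen–Duhamel identity, divergence-free slices — the
four fields of `…Defs.InDoorClass`, spelled out so that this file imports no route file) and every `s < 0`, `r ≠ 0`, `z`: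
`∂ₛΓ = Γ_rr − r⁻¹Γ_r + Γ_zz − (∂ᵣS + r⁻¹S + ∂_zP)` (the class is classical on `Iio 0` for one smooth pressure:
`isTypeIAncientMild_of_class`, `exists_isClassicalNSSolutionOn_Iio_of_isTypeIAncientMild`). -/
theorem circ_conservation_law_of_class {C : ℝ} (hrate : HasTypeITimeDecay C v)
    (hcont : ContinuousOn (uncurry v) (Iio (0 : ℝ) ×ˢ univ))
    (hmild : ∀ s t : ℝ, s < t → t < 0 → ∀ x, v t x = heatExtension (v s) (t - s) x - oseenDuhamel 1 s v v t x)
    (hdiv : ∀ t < 0, VectorCalculus.IsDivFree (v t)) {s : ℝ} (hs : s < 0) {r : ℝ} (hr : r ≠ 0) (z : ℝ) :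
    deriv (fun s' => circ v r z s') s
      = deriv (fun r' => deriv (fun r'' => circ v r'' z s) r') r - r⁻¹ * deriv (fun r' => circ v r' z s) r
        + deriv (fun z' => deriv (fun z'' => circ v r z'' s) z') z
        - (deriv (fun r' => ∫ θ in (0 : ℝ)..(2 * Real.pi), ⟪v s (cylPt r' θ z), eR θ⟫_ℝ * ⟪v s (cylPt r' θ z), eT θ⟫_ℝ * r') r
            + r⁻¹ * (∫ θ in (0 : ℝ)..(2 * Real.pi), ⟪v s (cylPt r θ z), eR θ⟫_ℝ * ⟪v s (cylPt r θ z), eT θ⟫_ℝ * r)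
            + deriv (fun z' => ∫ θ in (0 : ℝ)..(2 * Real.pi), ⟪v s (cylPt r θ z'), e3⟫_ℝ * ⟪v s (cylPt r θ z'), eT θ⟫_ℝ * r) z) := by
  obtain ⟨p, hcl⟩ := exists_isClassicalNSSolutionOn_Iio_of_isTypeIAncientMild
    (isTypeIAncientMild_of_class hrate hcont hmild hdiv)
  exact circ_conservation_law isOpen_Iio hcl hs hr z

end Law

/-! ### The fluxes are controlled by the VELOCITY alone -/

section Bounds

/-- `|S(r,z,s)| ≤ 2π r B²` if `‖v(s)‖ ≤ B` on the circle `S(r,z)` and `r ≥ 0` (a bound on the integrand; no regularity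
of the slice is needed). -/
theorem abs_radFlux_le {s r z B : ℝ} (hr : 0 ≤ r)
    (hB : ∀ θ : ℝ, ‖v s (cylPt r θ z)‖ ≤ B) :
    |∫ θ in (0 : ℝ)..(2 * Real.pi), ⟪v s (cylPt r θ z), eR θ⟫_ℝ * ⟪v s (cylPt r θ z), eT θ⟫_ℝ * r| ≤ 2 * Real.pi * r * B ^ 2 := by
  have hB0 : 0 ≤ B := (norm_nonneg _).trans (hB 0)
  have h : ‖∫ θ in (0 : ℝ)..(2 * Real.pi), ⟪v s (cylPt r θ z), eR θ⟫_ℝ * ⟪v s (cylPt r θ z), eT θ⟫_ℝ * r‖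
      ≤ (B * B * r) * |2 * Real.pi - 0| :=
    intervalIntegral.norm_integral_le_of_norm_le_const fun θ _ => by
      rw [Real.norm_eq_abs, abs_mul, abs_mul, abs_of_nonneg hr]
      exact mul_le_mul_of_nonneg_right
        (mul_le_mul ((abs_inner_eR_le _ θ).trans (hB θ)) ((abs_inner_eT_le _ θ).trans (hB θ)) (abs_nonneg _) hB0) hr
  rw [sub_zero, abs_of_pos (by positivity), Real.norm_eq_abs] at h
  nlinarith [h]

/-- `|P(r,z,s)| ≤ 2π r B²` if `‖v(s)‖ ≤ B` on the circle `S(r,z)` and `r ≥ 0`. -/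
theorem abs_axFlux_le {s r z B : ℝ} (hr : 0 ≤ r)
    (hB : ∀ θ : ℝ, ‖v s (cylPt r θ z)‖ ≤ B) :
    |∫ θ in (0 : ℝ)..(2 * Real.pi), ⟪v s (cylPt r θ z), e3⟫_ℝ * ⟪v s (cylPt r θ z), eT θ⟫_ℝ * r| ≤ 2 * Real.pi * r * B ^ 2 := by
  have hB0 : 0 ≤ B := (norm_nonneg _).trans (hB 0)
  have h : ‖∫ θ in (0 : ℝ)..(2 * Real.pi), ⟪v s (cylPt r θ z), e3⟫_ℝ * ⟪v s (cylPt r θ z), eT θ⟫_ℝ * r‖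
      ≤ (B * B * r) * |2 * Real.pi - 0| :=
    intervalIntegral.norm_integral_le_of_norm_le_const fun θ _ => by
      rw [Real.norm_eq_abs, abs_mul, abs_mul, abs_of_nonneg hr]
      exact mul_le_mul_of_nonneg_right
        (mul_le_mul ((abs_inner_e3_le _).trans (hB θ)) ((abs_inner_eT_le _ θ).trans (hB θ)) (abs_nonneg _) hB0) hr
  rw [sub_zero, abs_of_pos (by positivity), Real.norm_eq_abs] at h
  nlinarith [h]

/-- **Type-I time rate ⇒ `|S(r,z,s)| ≤ 2π r C²/(−s)`** for `s < 0`, `r ≥ 0` (the door class's first field only). -/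
theorem abs_radFlux_le_of_class {C : ℝ} (hrate : HasTypeITimeDecay C v) {s : ℝ} (hs : s < 0) {r : ℝ} (hr : 0 ≤ r) (z : ℝ) :
    |∫ θ in (0 : ℝ)..(2 * Real.pi), ⟪v s (cylPt r θ z), eR θ⟫_ℝ * ⟪v s (cylPt r θ z), eT θ⟫_ℝ * r|
      ≤ 2 * Real.pi * r * (C ^ 2 / (-s)) := by
  have h := abs_radFlux_le (v := v) (z := z) (B := C / Real.sqrt (-s)) hr (fun θ => hrate s hs _)
  have hsq : (C / Real.sqrt (-s)) ^ 2 = C ^ 2 / (-s) := by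
    rw [div_pow, Real.sq_sqrt (by linarith)]
  rwa [hsq] at h

/-- **Type-I time rate ⇒ `|P(r,z,s)| ≤ 2π r C²/(−s)`** for `s < 0`, `r ≥ 0`. -/
theorem abs_axFlux_le_of_class {C : ℝ} (hrate : HasTypeITimeDecay C v) {s : ℝ} (hs : s < 0) {r : ℝ} (hr : 0 ≤ r) (z : ℝ) :
    |∫ θ in (0 : ℝ)..(2 * Real.pi), ⟪v s (cylPt r θ z), e3⟫_ℝ * ⟪v s (cylPt r θ z), eT θ⟫_ℝ * r|
      ≤ 2 * Real.pi * r * (C ^ 2 / (-s)) := by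
  have h := abs_axFlux_le (v := v) (z := z) (B := C / Real.sqrt (-s)) hr (fun θ => hrate s hs _)
  have hsq : (C / Real.sqrt (-s)) ^ 2 = C ^ 2 / (-s) := by
    rw [div_pow, Real.sq_sqrt (by linarith)]
  rwa [hsq] at h

end Bounds

end Summit.NavierStokesRegularity.NavierStokesRegularity.Theorems.HalfSpaceWindowDoorCirculationCarryingRigidityAngularFlux

end
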